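import Literature.Geometry.Lorentzian.CauchyHypersurfaceAboveCompact
import HarnessLib

/-!
# A Cauchy hypersurface above a compact set, re-based on an arbitrary Cauchy hypersurface

#harness_tags [topic Geometry/Lorentzian]

The "re-base" step toward the smoothing of rough Cauchy hypersurfaces (Bernal–Sánchez 2006, §3):

* `CauchyDevelopment.exists_isCauchyHypersurface_above_of_isCauchyHypersurface` — the rough-slice theorem
  `LorentzianMetric.IsCauchyHypersurface.exists_isCauchyHypersurface_above` (module `CauchyHypersurfaceAboveCompact`)
  holds in a Cauchy development for an ARBITRARY Cauchy hypersurface `S` as base (not only the data hypersurface):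
  its compactness hypothesis `J⁻(x) ∩ J⁺(S)` compact is O'Neill 1983, Lemma 14.40
  (`IsCauchyHypersurface.isCompact_causalPast_inter_causalFuture`), the `C¹` Levi-Civita instance being supplied as in
  `CauchyDevelopmentGlobalHyperbolicityProofs`.
Everything is proved; no definitions and no named facts are introduced. (Origin: decomp-fsc lens-4 g27 addendum, porting item P6; the slope-interval algebra P4 lives in `Summits/FinalStateConjecture/FinalStateConjecture/Theorems/SpacelikeSlopeInterval.lean`.)
References: O'Neill 1983, Ch. 14, Lemma 14.40 [ONeillSemiRiemannian1983]; Hawking–Ellis 1973, Prop. 6.6.6 [HawkingEllis1973CUP];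
Bernal–Sánchez 2006 (arXiv:gr-qc/0512095) §3 [BernalSanchez2006].
-/

open Set Function
open scoped Manifold ContDiff Topology

namespace Literature.Geometry.Lorentzian

universe u


/-! ### P6 + re-base: the rough-slice theorem over an arbitrary Cauchy hypersurface of a development -/

namespace CauchyDevelopment

variable {m : ℕ} {X : Type u} [TopologicalSpace X] [ChartedSpace (EuclideanSpace ℝ (Fin m)) X]
  [IsManifold (𝓡 m) ∞ X] [ConnectedSpace X] {D : InitialDataSet (𝓡 m) X}

/-- **In a Cauchy development there is, above every compact set, a Cauchy hypersurface equal to a GIVEN Cauchy hypersurface `S` off a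
compact set.** For every Cauchy hypersurface `S ⊆ M` of the development and every compact `C ⊆ M` there is a Cauchy hypersurface `A`
with `A ∖ K ⊆ S`, `S ∖ K ⊆ A` for a compact `K`, `C ⊆ I⁻(A)`, `S ⊆ J⁻(A)`, `A ⊆ J⁺(S)`. (`IsCauchyHypersurface.exists_isCauchyHypersurface_above`
with its hypotheses discharged by `CauchyDevelopment.isStronglyCausal`, `IsCauchyHypersurface.isCompact_causalPast_inter_causalFuture`
(O'Neill 1983, Lemma 14.40) and `CauchyDevelopment.isClosed_causalPast_singleton`.)
[cite: ONeillSemiRiemannian1983, Ch. 14, Lemma 14.40 (p. 423)] [cite: HawkingEllis1973CUP, §6.6, Prop. 6.6.6 (p. 211)] -/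
theorem exists_isCauchyHypersurface_above_of_isCauchyHypersurface (𝒟 : CauchyDevelopment D)
    {S C : Set 𝒟.carrier} (hS : 𝒟.metric.IsCauchyHypersurface 𝒟.timeOrientation S) (hC : IsCompact C) :
    ∃ A : Set 𝒟.carrier, 𝒟.metric.IsCauchyHypersurface 𝒟.timeOrientation A ∧
      (∃ K : Set 𝒟.carrier, IsCompact K ∧ A \ K ⊆ S ∧ S \ K ⊆ A) ∧
      C ⊆ 𝒟.metric.chronologicalPast 𝒟.timeOrientation A ∧
      S ⊆ 𝒟.metric.causalPast 𝒟.timeOrientation A ∧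
      A ⊆ 𝒟.metric.causalFuture 𝒟.timeOrientation S := by
  have h2 : (2 : ℕ∞ω) ≤ ∞ := WithTop.coe_le_coe.mpr le_top
  haveI : 𝒟.metric.HasLeviCivita := 𝒟.metric.toPseudoRiemannianMetric.hasLeviCivita
  haveI : CovariantDerivative.ContMDiffCovariantDerivative 𝒟.metric.leviCivita 1 := by
    haveI : Fact ((1 : ℕ∞ω) ≤ ∞) := ⟨by exact_mod_cast le_top⟩
    exact ⟨𝒟.metric.toPseudoRiemannianMetric.isLocallyContMDiff_leviCivita_holds 1
      (by rw [show ((1 : ℕ∞) : ℕ∞ω) + 1 = 2 by norm_num]; exact WithTop.coe_le_coe.2 le_top)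
      univ isOpen_univ⟩
  exact hS.exists_isCauchyHypersurface_above h2 𝒟.isStronglyCausal
    (fun x ↦ hS.isCompact_causalPast_inter_causalFuture le_rfl x) 𝒟.isClosed_causalPast_singleton hC

end CauchyDevelopment

end Literature.Geometry.Lorentzian
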